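import Summits.AtomisticToContinuum.HydrodynamicLimit.Theorems.EquilibriumFastWindowLD.Negative.ConservedWindowSums
import Summits.AtomisticToContinuum.HydrodynamicLimit.Theorems.OneFlightGossipEngineKineticCurrentsWindowLDUniformStaticHydroDominationPrelim

/-!
# `EquilibriumFastWindowLD` — negative knowledge (a.2): orthogonality to the MOMENTUM `v_j` is load-bearing

Support file for crux `stmt-AtomisticToContinuum-14440` (`TwoClocks.EquilibriumFastWindowLD`), written by
the standing disprover (cdisprove seat). `EquilibriumFastWindowLDWithoutOrthMomentum` is the crux with the
single clause `∀ x j, ∫ F(x,v) v_j M_{1,u₀,θ₀}(v) dv = 0` DELETED (all other tokens verbatim) and it is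
FALSE, unconditionally: the witness `F(x,v) = v⁰` is continuous, of quadratic growth, `⊥ 1` and `⊥ |v|²`
(parity; growth `|v⁰| ≤ 1 + ‖v‖²` is the landed `KineticCurrentsWindowLDUniformLocalGibbs.shd_abs_apply_le`), and its
window sum is the CONSERVED momentum `P⁰(z)` (`windowSum_coord_eq`), so at every window,
every flow and every `σ ≤ 1/2` the moment is the Gaussian value `(e^{β²/2})^{N+1}` (`windowMoment_coord_eq`),
against the allowed `e^{ε(N+1)}` at `ε = β²/4`: the conclusion fails at `β = β₀`, every `τ`, at `N = N₀`
(`a₀ = θ₀ = 1`, `u₀ = 0`, Alexander flows, any small `σ`). The momentum shells are exactly invariant; a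
Galilean tilt is never relaxed, and only `F ⊥ v_j` removes its first-order gain.
-/

noncomputable section

open MeasureTheory ProbabilityTheory Real Set
open scoped ENNReal

namespace Summit.AtomisticToContinuum.HydrodynamicLimit.Theorems.EquilibriumFastWindowLDNegative

open Literature.Analysis.FluidPDE Literature.MathematicalPhysics.KineticTheory
open Summit.AtomisticToContinuum.HydrodynamicLimit.Theorems.CorrectorPressureDecayNegative

/-- `TwoClocks.EquilibriumFastWindowLD` with the clause `F ⊥ v_j` (`∀ x j, ∫ F(x,v) v_j M = 0`) DELETED;
all other tokens verbatim. A variant statement refuted below, not a fact. -/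
def EquilibriumFastWindowLDWithoutOrthMomentum : Prop :=
  ∃ σ₀ : ℝ, 0 < σ₀ ∧ ∀ (a₀ θ₀ : ℝ) (u₀ : V3), 0 < a₀ → 0 < θ₀ → ∀ σ : ℝ, 0 < σ → σ < σ₀ →
    ∀ Φ : (N : ℕ) → HardSphereFlow (Torus.geometry (Fin 3)) (hsDiameter σ N) (N + 1),
    ∀ F : T3 × V3 → ℝ, Continuous F → (∃ C : ℝ, ∀ y, |F y| ≤ C * (1 + ‖y.2‖ ^ 2)) →
    (∀ x, ∫ v, F (x, v) * localMaxwellian 1 θ₀ u₀ v = 0) →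
    (∀ x, ∫ v, F (x, v) * ‖v‖ ^ 2 * localMaxwellian 1 θ₀ u₀ v = 0) →
    ∃ β₀ : ℝ, 0 < β₀ ∧ ∀ β : ℝ, |β| ≤ β₀ → ∀ ε : ℝ, 0 < ε → ∃ τ : ℝ, 0 < τ ∧ ∃ N₀ : ℕ,
      ∀ N : ℕ, N₀ ≤ N →
        ∫⁻ z, ENNReal.ofReal (Real.exp (β * ∑ i : Fin (N + 1),
            (τ * ((N : ℝ) + 1) ^ (-(1 / 3 : ℝ)))⁻¹ *
              ∫ r in (0 : ℝ)..(τ * ((N : ℝ) + 1) ^ (-(1 / 3 : ℝ))), F (((Φ N).flow r z) i)))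
          ∂(localGibbsLaw σ (fun _ => a₀) (fun _ => u₀) (fun _ => θ₀) N (Φ N)) ≤
        ENNReal.ofReal (Real.exp (ε * ((N : ℝ) + 1)))

/-- **(a.2) Orthogonality to the momentum is load-bearing.** [folklore] -/
theorem equilibriumFastWindowLD_false_without_orthMomentum : ¬ EquilibriumFastWindowLDWithoutOrthMomentum := by
  rintro ⟨σ₀, hσ₀, h⟩
  set σ : ℝ := min (σ₀ / 2) (1 / 4) with hσdef
  have hσpos : 0 < σ := lt_min (by linarith) (by norm_num)
  have hσlt : σ < σ₀ := (min_le_left _ _).trans_lt (by linarith)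
  have hσ2 : σ ≤ 1 / 2 := (min_le_right _ _).trans (by norm_num)
  have hσhalf : σ < 2⁻¹ := (min_le_right _ _).trans_lt (by norm_num)
  set Φ : (N : ℕ) → HardSphereFlow (Torus.geometry (Fin 3)) (hsDiameter σ N) (N + 1) :=
    fun N => Classical.choice (nonempty_flow hσpos hσhalf N) with hΦdef
  -- the witness `F(x,v) = v⁰`
  set F : T3 × V3 → ℝ := fun y => y.2 0 with hFdef
  have hFc : Continuous F := by rw [hFdef]; fun_prop
  have hFg : ∃ C : ℝ, ∀ y, |F y| ≤ C * (1 + ‖y.2‖ ^ 2) :=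
    ⟨1, fun y => by rw [hFdef, one_mul]; exact KineticCurrentsWindowLDUniformLocalGibbs.shd_abs_apply_le y.2 0⟩
  have hF1 : ∀ x : T3, ∫ v, F (x, v) * localMaxwellian 1 1 (0 : V3) v = 0 := fun x => by
    simp only [hFdef]; exact integral_coord_mul_localMaxwellian 1 0
  have hFE : ∀ x : T3, ∫ v, F (x, v) * ‖v‖ ^ 2 * localMaxwellian 1 1 (0 : V3) v = 0 := fun x => by
    simp only [hFdef]; exact integral_coord_mul_normSq_mul_localMaxwellian 1 0
  obtain ⟨β₀, hβ₀, hβ⟩ := h 1 1 0 one_pos one_pos σ hσpos hσlt Φ F hFc hFg hF1 hFE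
  have hβle : |β₀| ≤ β₀ := (abs_of_pos hβ₀).le
  obtain ⟨τ, hτ, N₀, hN⟩ := hβ β₀ hβle (β₀ ^ 2 / 4) (by positivity)
  have hw : 0 < τ * ((N₀ : ℝ) + 1) ^ (-(1 / 3 : ℝ)) := mul_pos hτ (Real.rpow_pos_of_pos (by positivity) _)
  have h0 := hN N₀ le_rfl
  have hval := windowMoment_coord_eq one_pos hσ2 N₀ (Φ N₀) 0 β₀ hw
  simp only [hFdef] at h0
  rw [hval, ← ENNReal.ofReal_pow (Real.exp_pos _).le, ← Real.exp_nat_mul,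
    ENNReal.ofReal_le_ofReal_iff (Real.exp_pos _).le, Real.exp_le_exp] at h0
  push_cast at h0
  nlinarith [sq_nonneg β₀, mul_pos (pow_pos hβ₀ 2) (show (0 : ℝ) < (N₀ : ℝ) + 1 by positivity)]

end Summit.AtomisticToContinuum.HydrodynamicLimit.Theorems.EquilibriumFastWindowLDNegative

end
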